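import Literature.Geometry.Riemannian.GradientSolitonIdentities
import Literature.Geometry.Riemannian.ThreeShrinkerEinsteinCase
import Literature.Geometry.Riemannian.L2HarmonicOneFormsSobolevProofs
import HarnessLib

/-!
# Schur's lemma: `Ric = φ g` in dimension `≠ 2` forces `φ` constant

For a pseudo-Riemannian (nondegenerate) `C^∞` metric `g` whose Ricci tensor is pointwise
proportional to the metric, `Ric_x = φ(x) g_x`, in dimension `n ≠ 2`, the scalar curvature has
vanishing differential, hence `S` and `φ = S/n` are constant on a connected manifold and `g` is
Einstein with a CONSTANT (O'Neill 1983, Ch. 3, Exercise 21; Petersen 2016, Lemma 3.1.2 / the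
classical lemma of Schur 1886). Proof, as printed: the contracted Bianchi identity `dS = 2 div Ric`
(`CoordBianchi.fderiv_scalAt'`) with `∇Ric = dφ ⊗ g` (`∇g = 0`) gives `dS = 2 dφ`, while the trace
gives `S = nφ`, `dS = n dφ`; so `(n − 2) dφ = 0`.

* coordinates (`MetricCoord`, components `G` on an open set `V`): `scalAt_eq_of_ricAt_eq_smul`
  (`S = nφ`), `IsMetricOn.cov₂At_ricAt_of_ricAt_eq_smul` (`∇_W Ric = dφ(W) G`),
  `IsMetricOn.fderiv_scalAt_of_ricAt_eq_smul` (`dS = 2dφ`),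
  `IsMetricOn.fderiv_scalAt_eq_zero_of_ricAt_eq_smul` (`dS = 0` when `dim E ≠ 2`);
* manifold: `ricAt_chartRep_of_ricci_eq_smul` (the hypothesis read in a chart),
  `mvfderiv_scalarCurvature_eq_zero_of_ricci_eq_smul`, then — with the tree's
  `apply_eq_of_mvfderiv_eq_zero` (`L2HarmonicOneFormsSobolevProofs.lean`: vanishing differential on
  a connected manifold forces constancy) — **`scalarCurvature_eq_of_ricci_eq_smul'`** (`S` is
  constant) and
  **`exists_ricci_eq_const_smul_of_ricci_eq_smul`** (`Ric = c g` with a constant `c`);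
* `ThreeShrinker.modelData_of_ricci_eq_fun_smul` — the conclusion of
  `threeShrinkerClassification_modelData` for the compact members of its binder whose Ricci tensor
  is pointwise proportional to the metric (Schur + `ThreeShrinker.modelData_of_ricci_eq_smul`), the
  form in which the compact case of the classification is reached by the tensor maximum principle
  (Eminenti–La Nave–Mantegazza 2008, §3: "`Ric ≥ R g/n` … easily implies that `(M, g)` is Einstein").

Everything is proved; no definitions of `Prop` type are introduced.

## References

* B. O'Neill, *Semi-Riemannian geometry with applications to relativity*, Academic Press 1983,
  Ch. 3, Cor. 3.54 and Exercise 3.21 (Schur). [ONeill1983]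
* J. M. Lee, *Introduction to Riemannian Manifolds*, 2nd ed., Springer GTM 176 (2018), Prop. 7.19
  (contracted Bianchi) and Problem 7-8 (Schur's lemma). [Lee2018]
* M. Eminenti, G. La Nave, C. Mantegazza, manuscripta math. 127 (2008), §3. [EminentiLanaveMantegazza2008]
-/

noncomputable section

set_option maxSynthPendingDepth 3

open Set Filter ContinuousLinearMap Module
open scoped Topology ContDiff Manifold

namespace Literature.Geometry.Lorentzian

namespace MetricCoord

variable {E : Type*} [NormedAddCommGroup E] [NormedSpace ℝ E] [FiniteDimensional ℝ E]
  {G : E → E →L[ℝ] E →L[ℝ] ℝ} {V : Set E} {x : E} {φ : E → ℝ}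

/-- `S = φ · dim E` when `Ric = φ G` at a point. [cite: ONeill1983, Ch. 3, Lemma 3.52 ff.] -/
theorem scalAt_eq_of_ricAt_eq_smul (hi : (G x).IsInvertible) {c : ℝ}
    (hRic : ∀ v w, ricAt G x v w = c * G x v w) : scalAt G x = c * finrank ℝ E := by
  have hform : ricAt G x = c • G x := by
    ext v w
    simpa using hRic v w
  rw [scalAt, hform, mtrAt_smul, mtrAt_self hi]

variable [CompleteSpace E]

omit [CompleteSpace E] in
/-- **`(∇_W Ric)(Y,Z) = dφ(W) G(Y,Z)` when `Ric = φG` near `x`** (`∇G = 0`,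
`CoordHarmonicCurvature.cov₂At_self`). [cite: ONeill1983, Ch. 3, Exercise 3.21] -/
theorem IsMetricOn.cov₂At_ricAt_of_ricAt_eq_smul (hG : IsMetricOn G V) (hx : x ∈ V)
    (hφ : DifferentiableAt ℝ φ x) (hRic : ∀ y ∈ V, ∀ v w, ricAt G y v w = φ y * G y v w)
    (W Y Z : E) : cov₂At G (ricAt G) x W Y Z = fderiv ℝ φ x W * G x Y Z := by
  have hform : ∀ y ∈ V, ricAt G y = φ y • G y := fun y hy ↦ by
    ext v w
    simpa using hRic y hy v w
  have hev : ricAt G =ᶠ[𝓝 x] fun y ↦ φ y • G y := (hG.eventually_mem hx).mono hform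
  have hD : fderiv ℝ (ricAt G) x W Y Z =
      fderiv ℝ φ x W * G x Y Z + φ x * fderiv ℝ G x W Y Z := by
    rw [hev.fderiv_eq, fderiv_fun_smul hφ (hG.differentiableAt hx)]
    simp only [_root_.add_apply, FunLike.coe_smul, Pi.smul_apply, smul_eq_mul,
      ContinuousLinearMap.smulRight_apply]
    ring
  have h0 : cov₂At G G x W Y Z = 0 := by rw [hG.cov₂At_self hx]; rfl
  rw [cov₂At_apply] at h0 ⊢
  rw [hD, hRic x hx (chrAt G x W Y) Z, hRic x hx Y (chrAt G x W Z)]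
  linear_combination (φ x) * h0

/-- **`dS = 2 dφ` when `Ric = φG`** (the contracted Bianchi identity `dS = 2 div Ric`).
[cite: ONeill1983, Ch. 3, Cor. 3.54 and Exercise 3.21] -/
theorem IsMetricOn.fderiv_scalAt_of_ricAt_eq_smul (hG : IsMetricOn G V) (hx : x ∈ V)
    (hφ : DifferentiableAt ℝ φ x) (hRic : ∀ y ∈ V, ∀ v w, ricAt G y v w = φ y * G y v w)
    (Y : E) : fderiv ℝ (scalAt G) x Y = 2 * fderiv ℝ φ x Y := by
  set b := finBasis ℝ E with hb
  have hi := hG.isInvertible x hx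
  have hs := hG.symm x hx
  rw [hG.fderiv_scalAt' b hx Y]
  simp only [hG.cov₂At_ricAt_of_ricAt_eq_smul hx hφ hRic]
  congr 1
  calc ∑ k, ∑ l, ginv G b x k l * (fderiv ℝ φ x (b k) * G x (b l) Y)
      = ∑ k, fderiv ℝ φ x (b k) * b.coord k Y := by
        refine Finset.sum_congr rfl fun k _ ↦ ?_
        rw [coord_eq_sum_ginv b hi Y k, Finset.mul_sum]
        refine Finset.sum_congr rfl fun l _ ↦ ?_
        rw [hs (b l) Y]
        ring
    _ = fderiv ℝ φ x (∑ k, b.coord k Y • b k) := by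
        rw [map_sum]
        refine Finset.sum_congr rfl fun k _ ↦ ?_
        rw [map_smul, smul_eq_mul, mul_comm]
    _ = fderiv ℝ φ x Y := by
        simp only [Basis.coord_apply, Basis.sum_repr]

/-- **Schur in coordinates**: if `Ric = φG` on `V` and `dim E ≠ 2` then `dS = 0` on `V`
(`dS = 2dφ` and `S = (dim E) φ`). [cite: ONeill1983, Ch. 3, Exercise 3.21] -/
theorem IsMetricOn.fderiv_scalAt_eq_zero_of_ricAt_eq_smul (hG : IsMetricOn G V) (hx : x ∈ V)
    (hRic : ∀ y ∈ V, ∀ v w, ricAt G y v w = φ y * G y v w) (hn : finrank ℝ E ≠ 2) :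
    fderiv ℝ (scalAt G) x = 0 := by
  rcases Nat.eq_zero_or_pos (finrank ℝ E) with h0 | hpos
  · haveI : Subsingleton E := Module.finrank_zero_iff.mp h0
    ext v
    rw [Subsingleton.elim v 0, map_zero, map_zero]
  · have hn0 : (finrank ℝ E : ℝ) ≠ 0 := by exact_mod_cast hpos.ne'
    -- `φ = S / n` near `x`, hence differentiable there
    have hφS : ∀ y ∈ V, φ y = (finrank ℝ E : ℝ)⁻¹ * scalAt G y := fun y hy ↦ by
      rw [scalAt_eq_of_ricAt_eq_smul (hG.isInvertible y hy) (hRic y hy)]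
      field_simp
    have hev : φ =ᶠ[𝓝 x] fun y ↦ (finrank ℝ E : ℝ)⁻¹ • scalAt G y :=
      (hG.eventually_mem hx).mono fun y hy ↦ by simp only [smul_eq_mul]; exact hφS y hy
    have hSd : DifferentiableAt ℝ (scalAt G) x := (hG.contDiffAt_scalAt hx).differentiableAt (by simp)
    have hφD : HasFDerivAt φ ((finrank ℝ E : ℝ)⁻¹ • fderiv ℝ (scalAt G) x) x :=
      (hSd.hasFDerivAt.const_smul _).congr_of_eventuallyEq hev
    ext Y
    have h1 := hG.fderiv_scalAt_of_ricAt_eq_smul hx hφD.differentiableAt hRic Y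
    rw [hφD.fderiv, FunLike.coe_smul, Pi.smul_apply, smul_eq_mul] at h1
    -- `dS(Y) = (2/n) dS(Y)` with `n ≠ 2`
    have h2 : ((finrank ℝ E : ℝ) - 2) * fderiv ℝ (scalAt G) x Y = 0 := by
      have hinv : (finrank ℝ E : ℝ) * (finrank ℝ E : ℝ)⁻¹ = 1 := mul_inv_cancel₀ hn0
      calc ((finrank ℝ E : ℝ) - 2) * fderiv ℝ (scalAt G) x Y
          = (finrank ℝ E : ℝ) * fderiv ℝ (scalAt G) x Y - 2 * fderiv ℝ (scalAt G) x Y := by ring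
        _ = (finrank ℝ E : ℝ) * (2 * ((finrank ℝ E : ℝ)⁻¹ * fderiv ℝ (scalAt G) x Y))
              - 2 * fderiv ℝ (scalAt G) x Y := by rw [← h1]
        _ = 2 * ((finrank ℝ E : ℝ) * (finrank ℝ E : ℝ)⁻¹) * fderiv ℝ (scalAt G) x Y
              - 2 * fderiv ℝ (scalAt G) x Y := by ring
        _ = 0 := by rw [hinv]; ring
    have hn2 : (finrank ℝ E : ℝ) - 2 ≠ 0 := by
      have : (finrank ℝ E : ℝ) ≠ 2 := by exact_mod_cast hn
      exact sub_ne_zero.mpr this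
    rw [_root_.zero_apply]
    exact (mul_eq_zero.mp h2).resolve_left hn2

end MetricCoord

end Literature.Geometry.Lorentzian

namespace Literature.Geometry.Riemannian

open Lorentzian Lorentzian.PseudoRiemannianMetric

section Manifold

variable {E : Type*} [NormedAddCommGroup E] [NormedSpace ℝ E] [FiniteDimensional ℝ E]
  {H : Type*} [TopologicalSpace H] {I : ModelWithCorners ℝ E H} [I.Boundaryless]
  {M : Type*} [TopologicalSpace M] [ChartedSpace H M] [IsManifold I ∞ M]
  (g : PseudoRiemannianMetric I ∞ E (TangentSpace I : M → Type _)) [g.HasLeviCivita]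

/-- **`Ric = φ g` read in a chart**: the chart components satisfy `ricAt G = (φ ∘ φ⁻¹_chart) G` on
the chart target. [cite: ONeill1983, Ch. 3, Prop. 3.59] -/
theorem ricAt_chartRep_of_ricci_eq_smul (x₀ : M) {φ : M → ℝ}
    (hRic : ∀ (x : M) (X Y : TangentSpace I x), g.ricci x X Y = φ x * g.val x X Y) :
    ∀ y ∈ (extChartAt I x₀).target, ∀ v w : E,
      MetricCoord.ricAt (chartRep I (fun _ ↦ g) x₀ 0) y v w =
        (φ ∘ (extChartAt I x₀).symm) y * chartRep I (fun _ ↦ g) x₀ 0 y v w := by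
  intro y hy v w
  haveI := (chartPullback I g x₀).hasLeviCivita
  have hG := val_chartPullback_eq_chartRep (fun _ : ℝ ↦ g) x₀ 0
  set u : chartTarget I x₀ := ⟨y, hy⟩
  rw [show y = (u : E) from rfl, ← Lorentzian.OpensChart.ricci_eq_ricAt hG u,
    g.ricci_comap_apply contMDiff_pullbackBilin_holds (contMDiff_chartInv x₀)
      (injective_mfderiv_chartInv x₀) rfl u, chartRep_apply, val_chartPullback_apply]
  exact hRic _ _ _

/-- **Schur's lemma, differential form**: if `Ric = φ g` pointwise on a manifold of dimension
`≠ 2`, then `dS = 0` everywhere. [cite: ONeill1983, Ch. 3, Exercise 3.21] [cite: Lee2018, Problem 7-8] -/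
theorem mvfderiv_scalarCurvature_eq_zero_of_ricci_eq_smul (hn : finrank ℝ E ≠ 2) {φ : M → ℝ}
    (hRic : ∀ (x : M) (X Y : TangentSpace I x), g.ricci x X Y = φ x * g.val x X Y) (x : M) :
    mvfderiv I g.scalarCurvature x = 0 := by
  set G := chartRep I (fun _ ↦ g) x 0 with hGdef
  have hGm : MetricCoord.IsMetricOn G (extChartAt I x).target :=
    Lorentzian.OpensChart.isMetricOn_repr (val_chartPullback_eq_chartRep (fun _ : ℝ ↦ g) x 0)
  have hu0 : extChartAt I x x ∈ (extChartAt I x).target := mem_extChartAt_target x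
  set u₀ : chartTarget I x := ⟨extChartAt I x x, hu0⟩ with hu₀def
  have hΦu₀ : chartInv I x u₀ = x := extChartAt_to_inv x
  have key := hGm.fderiv_scalAt_eq_zero_of_ricAt_eq_smul hu0 (ricAt_chartRep_of_ricci_eq_smul g x hRic) hn
  suffices h : mvfderiv I g.scalarCurvature (chartInv I x u₀) = 0 by rwa [hΦu₀] at h
  have hinv := isInvertible_mfderiv_of_injective rfl (injective_mfderiv_chartInv x u₀)
  have hSd : MDifferentiableAt I 𝓘(ℝ, ℝ) g.scalarCurvature (chartInv I x u₀) :=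
    (contMDiff_scalarCurvature g).mdifferentiableAt (by simp)
  have hSrep : (g.scalarCurvature ∘ (extChartAt I x).symm) =ᶠ[𝓝 (u₀ : E)]
      MetricCoord.scalAt G := by
    filter_upwards [(isOpen_extChartAt_target x).mem_nhds hu0] with z hz
    exact Lorentzian.scalarCurvature_chartInv_eq g x ⟨z, hz⟩
  ext Y'
  obtain ⟨Yc, rfl⟩ : ∃ Yc : E, mfderiv 𝓘(ℝ, E) I (chartInv I x) u₀ Yc = Y' :=
    ⟨(mfderiv 𝓘(ℝ, E) I (chartInv I x) u₀).inverse Y', by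
      rw [← ContinuousLinearMap.comp_apply, hinv.self_comp_inverse]; rfl⟩
  rw [mvfderiv_chartInv_apply_eq_fderiv x u₀ hSd Yc, hSrep.fderiv_eq, key]
  rfl

/-- **Schur's lemma**: if `Ric = φ g` pointwise on a connected manifold of dimension `≠ 2`, the
scalar curvature is constant. [cite: ONeill1983, Ch. 3, Exercise 3.21] [cite: Lee2018, Problem 7-8] -/
theorem scalarCurvature_eq_of_ricci_eq_smul' [ConnectedSpace M] (hn : finrank ℝ E ≠ 2)
    {φ : M → ℝ} (hRic : ∀ (x : M) (X Y : TangentSpace I x), g.ricci x X Y = φ x * g.val x X Y)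
    (x y : M) : g.scalarCurvature x = g.scalarCurvature y :=
  apply_eq_of_mvfderiv_eq_zero (I := I)
    (fun z ↦ (contMDiff_scalarCurvature g).mdifferentiableAt (by simp))
    (mvfderiv_scalarCurvature_eq_zero_of_ricci_eq_smul g hn hRic) x y

omit [I.Boundaryless] in
/-- The trace of `Ric = φ g` at a point: `S = φ · dim`. [cite: ONeill1983, Ch. 3, Lemma 3.52 ff.] -/
theorem scalarCurvature_eq_of_ricci_eq_smul_at {φ : M → ℝ} {x : M}
    (hRic : ∀ X Y : TangentSpace I x, g.ricci x X Y = φ x * g.val x X Y) :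
    g.scalarCurvature x = φ x * finrank ℝ E := by
  have hform : g.ricci x = φ x • g.toBilinForm x := by
    refine LinearMap.ext₂ fun X Y ↦ ?_
    simpa using hRic X Y
  rw [scalarCurvature, hform, trace_smul, trace_toBilinForm_eq]

/-- **Schur's lemma**: if `Ric = φ g` pointwise on a connected manifold of dimension `≠ 2`, then
`Ric = c g` for a CONSTANT `c` (namely `c = S/dim`). [cite: ONeill1983, Ch. 3, Exercise 3.21]
[cite: Lee2018, Problem 7-8] -/
theorem exists_ricci_eq_const_smul_of_ricci_eq_smul [ConnectedSpace M] (hn : finrank ℝ E ≠ 2)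
    {φ : M → ℝ} (hRic : ∀ (x : M) (X Y : TangentSpace I x), g.ricci x X Y = φ x * g.val x X Y) :
    ∃ c : ℝ, ∀ (x : M) (X Y : TangentSpace I x), g.ricci x X Y = c * g.val x X Y := by
  rcases isEmpty_or_nonempty M with hM | ⟨⟨x₀⟩⟩
  · exact ⟨0, fun x ↦ (IsEmpty.false x).elim⟩
  rcases Nat.eq_zero_or_pos (finrank ℝ E) with h0 | hpos
  · haveI : Subsingleton E := Module.finrank_zero_iff.mp h0
    refine ⟨0, fun x X Y ↦ ?_⟩
    have hX : X = 0 := Subsingleton.elim (α := E) X 0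
    subst hX
    simp
  · refine ⟨φ x₀, fun x X Y ↦ ?_⟩
    have hS := scalarCurvature_eq_of_ricci_eq_smul' g hn hRic x x₀
    rw [scalarCurvature_eq_of_ricci_eq_smul_at g (hRic x),
      scalarCurvature_eq_of_ricci_eq_smul_at g (hRic x₀)] at hS
    have hn0 : (finrank ℝ E : ℝ) ≠ 0 := by exact_mod_cast hpos.ne'
    have hφ : φ x = φ x₀ := mul_right_cancel₀ hn0 hS
    rw [hRic, hφ]

end Manifold

/-! ### The binder of `threeShrinkerClassification_modelData` -/

namespace ThreeShrinker

open MeasureTheory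

/-- **The conclusion of `threeShrinkerClassification_modelData` for compact members of its binder
whose Ricci tensor is pointwise proportional to the metric** (`Ric_x = ρ(x) h_x`): by Schur's lemma
(`exists_ricci_eq_const_smul_of_ricci_eq_smul`, dimension `3 ≠ 2`) `ρ` is constant, and
`ThreeShrinker.modelData_of_ricci_eq_smul` (Einstein ⇒ round space form ⇒ disjunct (a)) applies.
This is the form in which the compact case is reached from the tensor maximum principle
(Eminenti–La Nave–Mantegazza 2008, §3). [cite: EminentiLanaveMantegazza2008, §3]
[cite: MunteanuWang2016, Thm 1.2 (p. 3)] [cite: Lee2018, Problem 7-8] -/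
theorem modelData_of_ricci_eq_fun_smul (N : Type*) [TopologicalSpace N] [T2Space N]
    [ChartedSpace (EuclideanSpace ℝ (Fin 3)) N] [IsManifold (𝓡 3) ∞ N] [CompactSpace N]
    [ConnectedSpace N] [MeasurableSpace N] [BorelSpace N] [T3Space N]
    (g : PseudoRiemannianMetric (𝓡 3) ∞ (EuclideanSpace ℝ (Fin 3))
      (TangentSpace (𝓡 3) : N → Type _)) [g.HasLeviCivita] (hg : g.IsRiemannian)
    (φ : N → ℝ) (hφ : ContMDiff (𝓡 3) 𝓘(ℝ, ℝ) ∞ φ)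
    (hsol : ∀ (x : N) (X Y : TangentSpace (𝓡 3) x),
      g.ricci x X Y + g.hessian φ x X Y = (1 / 2 : ℝ) * g.val x X Y)
    (hnorm : ∀ x : N, g.scalarCurvature x + g.gradSq φ x = φ x)
    {ρ : N → ℝ} (hRic : ∀ (x : N) (X Y : TangentSpace (𝓡 3) x), g.ricci x X Y = ρ x * g.val x X Y) :
    ((∀ x : N, g.scalarCurvature x = 0) ∧
        ∫⁻ x, ENNReal.ofReal (Real.exp (-φ x))
            ∂(riemannianMeasure (g.toContMDiffRiemannianMetric hg)) =
          ENNReal.ofReal (8 * Real.pi * Real.sqrt Real.pi)) ∨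
    (CompactSpace N ∧ (∀ x : N, g.scalarCurvature x = 3 / 2) ∧ (∀ x : N, φ x = 3 / 2) ∧
        ∃ k : ℕ, 0 < k ∧
          riemannianMeasure (g.toContMDiffRiemannianMetric hg) Set.univ =
            ENNReal.ofReal (16 * Real.pi ^ 2 / k)) ∨
    ((∀ x : N, g.scalarCurvature x = 1) ∧
        ∫⁻ x, ENNReal.ofReal (Real.exp (-φ x))
            ∂(riemannianMeasure (g.toContMDiffRiemannianMetric hg)) =
          ENNReal.ofReal (16 * Real.pi * Real.sqrt Real.pi * Real.exp (-1))) ∨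
    ((∀ x : N, g.scalarCurvature x = 1) ∧
        ∫⁻ x, ENNReal.ofReal (Real.exp (-φ x))
            ∂(riemannianMeasure (g.toContMDiffRiemannianMetric hg)) =
          ENNReal.ofReal (8 * Real.pi * Real.sqrt Real.pi * Real.exp (-1))) := by
  have h3 : finrank ℝ (EuclideanSpace ℝ (Fin 3)) ≠ 2 := by
    rw [finrank_euclideanSpace_fin]; decide
  obtain ⟨c, hc⟩ := exists_ricci_eq_const_smul_of_ricci_eq_smul g h3 hRic
  exact modelData_of_ricci_eq_smul N g hg φ hφ hsol hnorm hc

end ThreeShrinker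

end Literature.Geometry.Riemannian

end
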